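import Mathlib.Topology.Algebra.OpenSubgroup
import Mathlib.GroupTheory.ResiduallyFinite
import Mathlib.GroupTheory.FiniteIndexNormalSubgroup
import HarnessLib

/-!
# Topological groups with a basis of open normal subgroups with residually finite quotients

Topic `Literature/Topology/Algebra`.  The soft lemma behind [SemiAnbd] Prop. 3.6 (iii)
(Mochizuki, *Semi-graphs of anabelioids*, Publ. RIMS 42 (2006), p. 39: "`π₁^temp(G)` is the
inverse limit of the `Gal(H'_i/G)`, each residually finite, so `π₁^temp(G) ↪ π̂₁(G)`"): if a
`T₁` topological group `G` has, inside every neighbourhood of `1`, an open normal subgroup `N` with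
`G/N` residually finite (as an abstract group), then the open normal subgroups OF FINITE INDEX of
`G` separate points — i.e. `G` injects into its profinite completion taken over open finite-index
normal subgroups.  Proof: for `g ≠ 1` pick such an `N ⊆ {g}ᶜ`, separate the image of `g` in `G/N`
by a finite-index normal subgroup and pull it back (it contains the open `N`, so it is open).
Written for G10 rung 2 (`TemperedPiResiduallyFinite`) of the abc-iut cell, layer L3.
-/

namespace Literature.Topology.Algebra

open _root_.Topology

universe u

variable {G : Type u} [Group G] [TopologicalSpace G]

/-- Pull-back of a finite-index normal subgroup of `G/N`, `N` an open normal subgroup, is an open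
normal subgroup of finite index of `G` containing `N`. [cite: MochizukiSemiAnbd2006, Prop 3.6(iii) p.39] -/
theorem exists_openNormalSubgroup_comap [ContinuousMul G] (N : OpenNormalSubgroup G)
    (M : FiniteIndexNormalSubgroup (G ⧸ N.toSubgroup)) :
    ∃ K : OpenNormalSubgroup G, K.toSubgroup = M.toSubgroup.comap (QuotientGroup.mk' N.toSubgroup) ∧
      K.toSubgroup.FiniteIndex := by
  let K₀ : FiniteIndexNormalSubgroup G := M.comap (QuotientGroup.mk' N.toSubgroup)
  have hle : N.toSubgroup ≤ K₀.toSubgroup := by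
    intro x hx
    change QuotientGroup.mk' N.toSubgroup x ∈ M.toSubgroup
    rw [QuotientGroup.mk'_apply, (QuotientGroup.eq_one_iff x).mpr hx]
    exact M.toSubgroup.one_mem
  have hopen : IsOpen (K₀.toSubgroup : Set G) := Subgroup.isOpen_mono hle N.isOpen
  exact ⟨{ toSubgroup := K₀.toSubgroup, isOpen' := hopen, isNormal' := K₀.isNormal' }, rfl,
    K₀.isFiniteIndex'⟩

/-- **The soft lemma of [SemiAnbd] Prop. 3.6 (iii)**: if every neighbourhood of `1` in the `T₁`
topological group `G` contains an open normal subgroup with residually finite quotient, then for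
every `g ≠ 1` there is an open normal subgroup of finite index not containing `g`.
[cite: MochizukiSemiAnbd2006, Prop 3.6(iii) p.39] -/
theorem exists_finiteIndex_openNormalSubgroup_notMem [ContinuousMul G] [T1Space G]
    (hbasis : ∀ U ∈ 𝓝 (1 : G), ∃ N : OpenNormalSubgroup G,
      (N : Set G) ⊆ U ∧ Group.ResiduallyFinite (G ⧸ N.toSubgroup))
    (g : G) (hg : g ≠ 1) :
    ∃ K : OpenNormalSubgroup G, K.toSubgroup.FiniteIndex ∧ g ∉ K := by
  obtain ⟨N, hNU, hN⟩ := hbasis {g}ᶜ (isOpen_compl_singleton.mem_nhds fun h => hg h.symm)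
  have hgN : g ∉ N := fun h => hNU h rfl
  have hgbar : (QuotientGroup.mk g : G ⧸ N.toSubgroup) ≠ 1 := fun h =>
    hgN ((QuotientGroup.eq_one_iff g).mp h)
  haveI := hN
  obtain ⟨M, hM⟩ := Group.exists_finiteIndexNormalSubgroup_notMem _ hgbar
  obtain ⟨K, hK, hKfi⟩ := exists_openNormalSubgroup_comap N M
  refine ⟨K, hKfi, fun h => hM ?_⟩
  have h' : g ∈ K.toSubgroup := h
  rw [hK] at h'
  exact h'

/-- The same, in the shape "`Finite (G ⧸ K)` and `g ∉ (K : Set G)`" used by the abc-iut cell's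
named fact `TemperedPiResiduallyFinite`. [cite: MochizukiSemiAnbd2006, Prop 3.6(iii) p.39] -/
theorem exists_openNormalSubgroup_finite_quotient_notMem [ContinuousMul G] [T1Space G]
    (hbasis : ∀ U ∈ 𝓝 (1 : G), ∃ N : OpenNormalSubgroup G,
      (N : Set G) ⊆ U ∧ Group.ResiduallyFinite (G ⧸ N.toSubgroup))
    (g : G) (hg : g ≠ 1) :
    ∃ K : OpenNormalSubgroup G, Finite (G ⧸ K.toSubgroup) ∧ g ∉ (K : Set G) := by
  obtain ⟨K, hK, hgK⟩ := exists_finiteIndex_openNormalSubgroup_notMem hbasis g hg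
  haveI := hK
  exact ⟨K, Subgroup.finite_quotient_of_finiteIndex, hgK⟩

end Literature.Topology.Algebra
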